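import Summits.CriticalPhenomena.PercolationContinuityZ3.Theorems.PercNearOneGluingNoHeavyLowerTailSunflowerGradedSafe
import Summits.CriticalPhenomena.PercolationContinuityZ3.Theorems.PercNearOneGluingNoHeavyLowerTailSunflowerGradedSafeCNF
import HarnessLib

/-!
# `NoHeavyLowerTail` (crux stmt-CriticalPhenomena-4575), abstract sunflower cubic: SAFE CORES — the calculus, part 3:
# READ-ONCE CORES OF CLASS S ARE SAFE (Lemma A / (C1-law) / H / G / T unconditional)

Support file (seat `prim-ineq-prove-1` gen 34; `--supports stmt-CriticalPhenomena-4575`).  No `sorry`, no named facts.  Memo: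
run/shared/lean/prim/prim-ineq-prove-1/FINDING-PRINCIPALCORE-prove1-g34.md §9.

A READ-ONCE CORE is the up-set of a monotone read-once formula: `ROF.leaf g` is the principal filter `{g ⊆ ω}` (a conjunction of the
variables in `g`), `ROF.cnf 𝒞` the disjoint-clause CNF `⋀_{C ∈ 𝒞} ⋁_{e ∈ C} x_e` (`SafeCalc.clauseCore`), `ROF.and F G = F ∩ G`,
`ROF.or F G = F ∪ G`; well-formed (`ROF.WF`) when the two operands of every gate have DISJOINT supports (and CNF leaves have pairwise
disjoint nonempty clauses).  `ROF.IsBase` = a disjunction of leaves / CNF leaves (an OR of disjoint-clause CNFs on disjoint blocks — the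
GRADEDLY safe shapes); the class `ROF.InS` ("class S′" of the memo) consists of the base formulas, the conjunctions of two class-S′
formulas, and the disjunctions of a base formula with a class-S′ formula.
* `ROF.gsafe_of_isBase` — every well-formed base formula is GRADEDLY safe on its support (`gsafe_principal`, `gsafe_clauseCore`, `gsafe_union`).
* **`ROF.safe_of_inS`** — every well-formed class-S′ read-once core is SAFE, for every product measure whose coordinates in the
  support have positive probability (`safe_principal`, `safe_clauseCore`, `safe_inter`, `safe_union_of_gsafe`); hence (part 1) Lemma A
  `μ(E₁)μ(E₂)μ(E₃) ≤ μ(A)²` (`ROF.lemmaA`), (C1-law) `e₃ ≤ max(a,b)(ab − e₂)` (`ROF.e3_le_max_mul_AG`), the `H`-row and Kahn's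
  Conjecture 5 on the complements (`ROF.lawH_nonneg`, `ROF.sahiE3_compl_nonneg`) for every three-petal sunflower of up-sets with such
  a core — no density hypothesis.
Class S′ contains: all Δ-system cores (`leaf h ∧ DNF`, the theorem of `…SunflowerDeltaCore`, here re-derived for positive `p`),
`(x₁ ∨ x₂) ∧ (x₃ ∨ x₄)`, `x₁ ∧ (x₂ ∨ x₃ ∧ (x₄ ∨ x₅))`, `x₂x₃ ∨ x₁(x₄ ∨ x₅)`, `x₁(x₂ ∨ x₃) ∨ x₄(x₅ ∨ x₆)` (an OR of two CNF leaves), and EVERY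
read-once formula on at most seven variables (a disjunction of two read-once formulas that are not ORs of disjoint-clause CNFs needs
≥ 4 + 4 variables; the first one outside, `x₁(x₂ ∨ x₃x₄) ∨ x₅(x₆ ∨ x₇x₈)`, is safe numerically — exact max-false-set criterion, memo §9).
Not covered either: non-read-once safe cores such as `{12,23,14}`.
-/

noncomputable section

namespace Summit.CriticalPhenomena.PercolationContinuityZ3.Theorems.SunflowerPartition

open MeasureTheory Finset
open Literature.Probability.LatticeModels Literature.Probability.Percolation

variable {ι : Type*}

namespace SafeCalc

/-- **Disjoint-clause CNF cores are gradedly safe** (`prod_BEx_le_of_clauseCore` in `GSafe` form). [this work] -/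
theorem gsafe_clauseCore [DecidableEq ι] [Fintype ι] (p : ι → unitInterval) (𝒞 : Finset (Finset ι))
    (h𝒞 : ∀ C ∈ 𝒞, ∀ D ∈ 𝒞, C ≠ D → Disjoint C D) (hne : ∀ C ∈ 𝒞, C.Nonempty) : GSafe p (𝒞.biUnion id) (clauseCore 𝒞) :=
  fun n _ hc hc1 G hanti hle1 hge _ hbad => prod_BEx_le_of_clauseCore p 𝒞 h𝒞 hne n hc hc1 G hanti hle1 hge hbad

/-- **Disjoint-clause CNF cores are safe.** [this work] -/
theorem safe_clauseCore [DecidableEq ι] [Fintype ι] (p : ι → unitInterval) (𝒞 : Finset (Finset ι))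
    (h𝒞 : ∀ C ∈ 𝒞, ∀ D ∈ 𝒞, C ≠ D → Disjoint C D) (hne : ∀ C ∈ 𝒞, C.Nonempty) : Safe p (clauseCore 𝒞) :=
  safe_of_gsafe p (𝒞.biUnion id) (determinedBy_clauseCore 𝒞) (isUpperSet_clauseCore 𝒞) (gsafe_clauseCore p 𝒞 h𝒞 hne)

end SafeCalc

/-- Monotone read-once formulas whose leaves are conjunctions of variables (principal filters) or disjoint-clause CNFs. [this work] -/
inductive ROF (ι : Type*) : Type _
  | leaf : Finset ι → ROF ι
  | cnf : Finset (Finset ι) → ROF ι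
  | and : ROF ι → ROF ι → ROF ι
  | or : ROF ι → ROF ι → ROF ι

namespace ROF

/-- The up-set defined by a formula. [this work] -/
def toSet : ROF ι → Set (Set ι)
  | leaf g => {ω | (↑g : Set ι) ⊆ ω}
  | cnf 𝒞 => SafeCalc.clauseCore 𝒞
  | .and F G => F.toSet ∩ G.toSet
  | .or F G => F.toSet ∪ G.toSet

/-- Base formulas: disjunctions of leaves and CNF leaves (ORs of disjoint-clause CNFs on disjoint blocks) — the gradedly safe shapes.
[this work] -/
def IsBase : ROF ι → Prop
  | leaf _ => True
  | cnf _ => True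
  | .and _ _ => False
  | .or F G => F.IsBase ∧ G.IsBase

/-- CLASS S′ (memo §9): base formulas, conjunctions of class-S′ formulas, disjunctions of a base formula with a class-S′ formula.
[this work] -/
def InS : ROF ι → Prop
  | leaf _ => True
  | cnf _ => True
  | .and F G => F.InS ∧ G.InS
  | .or F G => (F.IsBase ∧ G.InS) ∨ (F.InS ∧ G.IsBase)

/-- Base formulas are in class S′. [this work] -/
theorem inS_of_isBase : ∀ {F : ROF ι}, F.IsBase → F.InS
  | leaf _, _ => trivial
  | cnf _, _ => trivial
  | .and _ _, h => h.elim
  | .or _ _, h => Or.inl ⟨h.1, inS_of_isBase h.2⟩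

/-- The up-set of a formula is an up-set. [this work] -/
theorem isUpperSet_toSet : ∀ F : ROF ι, IsUpperSet F.toSet
  | leaf _ => fun _ _ hle hω => Set.Subset.trans hω hle
  | cnf 𝒞 => SafeCalc.isUpperSet_clauseCore 𝒞
  | .and F G => (isUpperSet_toSet F).inter (isUpperSet_toSet G)
  | .or F G => (isUpperSet_toSet F).union (isUpperSet_toSet G)

variable [DecidableEq ι]

/-- The support (set of variables read) of a formula. [this work] -/
def supp : ROF ι → Finset ι
  | leaf g => g
  | cnf 𝒞 => 𝒞.biUnion id
  | .and F G => F.supp ∪ G.supp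
  | .or F G => F.supp ∪ G.supp

/-- Well-formedness (READ-ONCE): the operands of every gate have disjoint supports; CNF leaves have pairwise disjoint nonempty
clauses. [this work] -/
def WF : ROF ι → Prop
  | leaf _ => True
  | cnf 𝒞 => (∀ C ∈ 𝒞, ∀ D ∈ 𝒞, C ≠ D → Disjoint C D) ∧ (∀ C ∈ 𝒞, C.Nonempty)
  | .and F G => F.WF ∧ G.WF ∧ Disjoint F.supp G.supp
  | .or F G => F.WF ∧ G.WF ∧ Disjoint F.supp G.supp

/-- The up-set of a formula is determined by its support. [this work] -/
theorem determinedBy_toSet : ∀ F : ROF ι, DeterminedBy F.toSet (↑F.supp : Set ι)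
  | leaf g => by
    rw [determinedBy_iff]
    intro ω ω' h
    change (↑g : Set ι) ⊆ ω ↔ (↑g : Set ι) ⊆ ω'
    constructor
    · intro hg e he
      exact ((Set.ext_iff.1 h e).1 ⟨hg he, he⟩).1
    · intro hg e he
      exact ((Set.ext_iff.1 h e).2 ⟨hg he, he⟩).1
  | cnf 𝒞 => SafeCalc.determinedBy_clauseCore 𝒞
  | .and F G => by
    have hF := (determinedBy_toSet F).mono (show (↑F.supp : Set ι) ⊆ ↑(F.supp ∪ G.supp) from
      Finset.coe_subset.2 Finset.subset_union_left)
    have hG := (determinedBy_toSet G).mono (show (↑G.supp : Set ι) ⊆ ↑(F.supp ∪ G.supp) from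
      Finset.coe_subset.2 Finset.subset_union_right)
    rw [determinedBy_iff] at hF hG ⊢
    intro ω ω' h
    exact and_congr (hF ω ω' h) (hG ω ω' h)
  | .or F G => by
    have hF := (determinedBy_toSet F).mono (show (↑F.supp : Set ι) ⊆ ↑(F.supp ∪ G.supp) from
      Finset.coe_subset.2 Finset.subset_union_left)
    have hG := (determinedBy_toSet G).mono (show (↑G.supp : Set ι) ⊆ ↑(F.supp ∪ G.supp) from
      Finset.coe_subset.2 Finset.subset_union_right)
    rw [determinedBy_iff] at hF hG ⊢
    intro ω ω' h
    exact or_congr (hF ω ω' h) (hG ω ω' h)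

/-- A formula determined by a block disjoint from `a` is determined by `aᶜ`. [this work] -/
theorem determinedBy_toSet_compl {a : Finset ι} (F : ROF ι) (h : Disjoint a F.supp) : DeterminedBy F.toSet (↑a : Set ι)ᶜ :=
  (determinedBy_toSet F).mono fun _ he hea => Finset.disjoint_left.1 h (Finset.mem_coe.1 hea) (Finset.mem_coe.1 he)

/-- Every configuration containing the support of a well-formed formula satisfies it. [this work] -/
theorem mem_toSet_of_supp_subset : ∀ (F : ROF ι), F.WF → ∀ {ω : Set ι}, (↑F.supp : Set ι) ⊆ ω → ω ∈ F.toSet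
  | leaf _, _, _, h => h
  | cnf _, hW, _, h => fun C hC => by
    obtain ⟨e, he⟩ := hW.2 C hC
    exact ⟨e, he, h (Finset.mem_coe.2 (Finset.mem_biUnion.2 ⟨C, hC, he⟩))⟩
  | .and F G, hW, _, h =>
    ⟨mem_toSet_of_supp_subset F hW.1 ((Finset.coe_subset.2 Finset.subset_union_left).trans h),
      mem_toSet_of_supp_subset G hW.2.1 ((Finset.coe_subset.2 Finset.subset_union_right).trans h)⟩
  | .or F _, hW, _, h => Or.inl (mem_toSet_of_supp_subset F hW.1 ((Finset.coe_subset.2 Finset.subset_union_left).trans h))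

/-- With positive coordinate probabilities on the support, a well-formed formula has positive probability. [this work] -/
theorem real_toSet_pos (p : ι → unitInterval) (F : ROF ι) (hW : F.WF) (hp : ∀ e ∈ F.supp, 0 < (p e : ℝ)) :
    0 < (prodBernoulli p).real F.toSet :=
  calc (0 : ℝ) < ∏ e ∈ F.supp, (p e : ℝ) := Finset.prod_pos hp
    _ = (prodBernoulli p).real {ω | (↑F.supp : Set ι) ⊆ ω} := (prodBernoulli_real_subset p F.supp).symm
    _ ≤ (prodBernoulli p).real F.toSet := measureReal_mono fun _ hω => mem_toSet_of_supp_subset F hW hω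

/-- **Well-formed base formulas are gradedly safe on their support.** [this work] -/
theorem gsafe_of_isBase [Fintype ι] (p : ι → unitInterval) : ∀ {F : ROF ι}, F.WF → F.IsBase → SafeCalc.GSafe p F.supp F.toSet
  | leaf g, _, _ => SafeCalc.gsafe_principal p g
  | cnf 𝒞, hW, _ => SafeCalc.gsafe_clauseCore p 𝒞 hW.1 hW.2
  | .and _ _, _, h => h.elim
  | .or F G, hW, hD =>
    SafeCalc.gsafe_union p hW.2.2 (determinedBy_toSet F) (determinedBy_toSet G) (gsafe_of_isBase p hW.1 hD.1)
      (gsafe_of_isBase p hW.2.1 hD.2)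

/-- **EVERY WELL-FORMED CLASS-S′ READ-ONCE CORE IS SAFE** (memo §9): Lemma A `∏ μ(V i) ≤ μ(A)^(n−1)` for every family of up-sets
meeting pairwise inside it, for every product measure with positive probabilities on the support. [this work] -/
theorem safe_of_inS [Fintype ι] (p : ι → unitInterval) :
    ∀ {F : ROF ι}, F.WF → F.InS → (∀ e ∈ F.supp, 0 < (p e : ℝ)) → SafeCalc.Safe p F.toSet
  | leaf g, _, _, _ => SafeCalc.safe_principal p g
  | cnf 𝒞, hW, _, _ => SafeCalc.safe_clauseCore p 𝒞 hW.1 hW.2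
  | .and F G, hW, hS, hp =>
    SafeCalc.safe_inter F.supp p (determinedBy_toSet F) (determinedBy_toSet_compl G hW.2.2)
      (safe_of_inS p hW.1 hS.1 fun e he => hp e (Finset.mem_union_left _ he))
      (safe_of_inS p hW.2.1 hS.2 fun e he => hp e (Finset.mem_union_right _ he))
  | .or F G, hW, hS, hp => by
    rcases hS with ⟨hF, hG⟩ | ⟨hF, hG⟩
    · exact SafeCalc.safe_union_of_gsafe p F.supp (determinedBy_toSet F) (determinedBy_toSet_compl G hW.2.2)
        (isUpperSet_toSet F) (isUpperSet_toSet G) (real_toSet_pos p G hW.2.1 fun e he => hp e (Finset.mem_union_right _ he))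
        (gsafe_of_isBase p hW.1 hF) (safe_of_inS p hW.2.1 hG fun e he => hp e (Finset.mem_union_right _ he))
    · have h := SafeCalc.safe_union_of_gsafe p G.supp (determinedBy_toSet G) (determinedBy_toSet_compl F hW.2.2.symm)
        (isUpperSet_toSet G) (isUpperSet_toSet F) (real_toSet_pos p F hW.1 fun e he => hp e (Finset.mem_union_left _ he))
        (gsafe_of_isBase p hW.2.1 hG) (safe_of_inS p hW.1 hF fun e he => hp e (Finset.mem_union_left _ he))
      change SafeCalc.Safe p (F.toSet ∪ G.toSet)
      rwa [Set.union_comm]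

/-! ## The law-level rows for sunflowers with a class-S′ read-once core -/

section Rows

variable [Fintype ι] (p : ι → unitInterval) {F : ROF ι} {E₁ E₂ E₃ : Set (Set ι)}

/-- **Lemma A** for a three-petal sunflower of up-sets whose core is a class-S′ read-once up-set:
`μ(E₁) μ(E₂) μ(E₃) ≤ μ(A)²`, for every product measure positive on the support. [this work] -/
theorem lemmaA (hW : F.WF) (hS : F.InS) (hp : ∀ e ∈ F.supp, 0 < (p e : ℝ)) (h₁ : IsUpperSet E₁) (h₂ : IsUpperSet E₂)
    (h₃ : IsUpperSet E₃) (h12 : E₁ ∩ E₂ = F.toSet) (h13 : E₁ ∩ E₃ = F.toSet) (h23 : E₂ ∩ E₃ = F.toSet) :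
    (prodBernoulli p).real E₁ * (prodBernoulli p).real E₂ * (prodBernoulli p).real E₃ ≤ ((prodBernoulli p).real F.toSet) ^ 2 :=
  SafeCalc.lemmaA_of_safe p (safe_of_inS p hW hS hp) h₁ h₂ h₃ h12 h13 h23

/-- **(C1-law)** `e₃ ≤ max(a,b)·(ab − e₂)` for every three-petal sunflower of up-sets with a class-S′ read-once core. [this work] -/
theorem e3_le_max_mul_AG (hW : F.WF) (hS : F.InS) (hp : ∀ e ∈ F.supp, 0 < (p e : ℝ)) (h₁ : IsUpperSet E₁)
    (h₂ : IsUpperSet E₂) (h₃ : IsUpperSet E₃) (h12 : E₁ ∩ E₂ = F.toSet) (h13 : E₁ ∩ E₃ = F.toSet) (h23 : E₂ ∩ E₃ = F.toSet) :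
    (prodBernoulli p).real (E₁ \ F.toSet) * (prodBernoulli p).real (E₂ \ F.toSet) * (prodBernoulli p).real (E₃ \ F.toSet) ≤
      max ((prodBernoulli p).real F.toSet) ((prodBernoulli p).real (E₁ ∪ E₂ ∪ E₃)ᶜ) *
        ((prodBernoulli p).real F.toSet * (prodBernoulli p).real (E₁ ∪ E₂ ∪ E₃)ᶜ -
          ((prodBernoulli p).real (E₁ \ F.toSet) * (prodBernoulli p).real (E₂ \ F.toSet) +
            (prodBernoulli p).real (E₁ \ F.toSet) * (prodBernoulli p).real (E₃ \ F.toSet) +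
            (prodBernoulli p).real (E₂ \ F.toSet) * (prodBernoulli p).real (E₃ \ F.toSet))) :=
  SafeCalc.e3_le_max_mul_AG_of_safe p (safe_of_inS p hW hS hp) h₁ h₂ h₃ h12 h13 h23

/-- **The `H`-row** `(a + b)(ab − e₂) ≥ e₃` for every three-petal sunflower of up-sets with a class-S′ read-once core. [this work] -/
theorem lawH_nonneg (hW : F.WF) (hS : F.InS) (hp : ∀ e ∈ F.supp, 0 < (p e : ℝ)) (h₁ : IsUpperSet E₁)
    (h₂ : IsUpperSet E₂) (h₃ : IsUpperSet E₃) (h12 : E₁ ∩ E₂ = F.toSet) (h13 : E₁ ∩ E₃ = F.toSet) (h23 : E₂ ∩ E₃ = F.toSet) :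
    0 ≤ ((prodBernoulli p).real F.toSet + (prodBernoulli p).real (E₁ ∪ E₂ ∪ E₃)ᶜ) *
        ((prodBernoulli p).real F.toSet * (prodBernoulli p).real (E₁ ∪ E₂ ∪ E₃)ᶜ -
          ((prodBernoulli p).real (E₁ \ F.toSet) * (prodBernoulli p).real (E₂ \ F.toSet) +
            (prodBernoulli p).real (E₁ \ F.toSet) * (prodBernoulli p).real (E₃ \ F.toSet) +
            (prodBernoulli p).real (E₂ \ F.toSet) * (prodBernoulli p).real (E₃ \ F.toSet))) -
      (prodBernoulli p).real (E₁ \ F.toSet) * (prodBernoulli p).real (E₂ \ F.toSet) * (prodBernoulli p).real (E₃ \ F.toSet) :=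
  SafeCalc.lawH_nonneg_of_safe p (safe_of_inS p hW hS hp) h₁ h₂ h₃ h12 h13 h23

/-- **Kahn's Conjecture 5 / Sahi `E₃ ≥ 0` for the complements** of a three-petal sunflower of up-sets with a class-S′ read-once core.
[this work] -/
theorem sahiE3_compl_nonneg (hW : F.WF) (hS : F.InS) (hp : ∀ e ∈ F.supp, 0 < (p e : ℝ)) (h₁ : IsUpperSet E₁)
    (h₂ : IsUpperSet E₂) (h₃ : IsUpperSet E₃) (h12 : E₁ ∩ E₂ = F.toSet) (h13 : E₁ ∩ E₃ = F.toSet) (h23 : E₂ ∩ E₃ = F.toSet) :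
    0 ≤ sahiE3 (prodBernoulli p) E₁ᶜ E₂ᶜ E₃ᶜ :=
  SafeCalc.sahiE3_compl_nonneg_of_safe p (safe_of_inS p hW hS hp) h₁ h₂ h₃ h12 h13 h23

end Rows

/-! ## Examples of class-S′ cores beyond Δ-systems -/

section Examples

omit [DecidableEq ι] in
/-- `(g₁ ∨ g₂) ∧ (g₃ ∨ g₄)` — the `C₄`-type core `{13,14,23,24}`: class S′ (a conjunction of two base formulas), not a Δ-system. [this work] -/
theorem inS_and_or_or (g₁ g₂ g₃ g₄ : Finset ι) : (ROF.and (.or (leaf g₁) (leaf g₂)) (.or (leaf g₃) (leaf g₄))).InS :=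
  ⟨Or.inl ⟨trivial, trivial⟩, Or.inl ⟨trivial, trivial⟩⟩

omit [DecidableEq ι] in
/-- `g₁ ∧ (g₂ ∨ g₃ ∧ (g₄ ∨ g₅))` — the core `{12,134,135}` (intersection graph a triangle, not a Δ-system): class S′. [this work] -/
theorem inS_nested (g₁ g₂ g₃ g₄ g₅ : Finset ι) :
    (ROF.and (leaf g₁) (.or (leaf g₂) (.and (leaf g₃) (.or (leaf g₄) (leaf g₅))))).InS :=
  ⟨trivial, Or.inl ⟨trivial, trivial, Or.inl ⟨trivial, trivial⟩⟩⟩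

omit [DecidableEq ι] in
/-- `g₁g₂… ∨ h ∧ (g₄ ∨ g₅)` — the core `{23,14,15}`: class S′ (a leaf OR a class-S′ conjunction). [this work] -/
theorem inS_leaf_or_and (g h g₄ g₅ : Finset ι) : (ROF.or (leaf g) (.and (leaf h) (.or (leaf g₄) (leaf g₅)))).InS :=
  Or.inl ⟨trivial, trivial, Or.inl ⟨trivial, trivial⟩⟩

omit [DecidableEq ι] in
/-- `x₁(x₂ ∨ x₃) ∨ x₄(x₅ ∨ x₆)` as an OR of two CNF leaves `{{1},{2,3}}`, `{{4},{5,6}}` — the core `{12,13,45,46}`: class S′ (a base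
formula; it was the first read-once core outside the DNF-based class S). [this work] -/
theorem inS_or_cnf_cnf (𝒞₁ 𝒞₂ : Finset (Finset ι)) : (ROF.or (cnf 𝒞₁) (cnf 𝒞₂)).InS :=
  Or.inl ⟨trivial, trivial⟩

end Examples

end ROF

end Summit.CriticalPhenomena.PercolationContinuityZ3.Theorems.SunflowerPartition
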